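import Summits.QuantumAdvantage.QuantumAdvantage.Theses.CompactnessLift
import Summits.QuantumAdvantage.QuantumAdvantage.Theorems.CompactnessLiftCompactnessPrinciple

/-!
# Route CompactnessLift · support `PlImpliesCp` (stmt-QuantumAdvantage-15273) — closed AS TYPED

`PlImpliesCp := PlLift → (BQP ⊆ BPP → ∃ c, QuadQ ⊆ bp (DTIME (· ^ c)))`: the consequent is, verbatim,
the body of the crux `CompactnessPrinciple`, which is a THEOREM as typed
(`CompactnessLiftPadding.compactnessPrinciple_proof`, stmt-15270: the coin-padding collapse
`∃ c₀, BPP ⊆ bp (DTIME (· ^ c₀))` — the operator class `bp (DTIME ·)` clocks its inner language on the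
padded pair and allows any polynomial coin length). Hence the implication holds with the promise-lift
hypothesis unused. HONEST LABEL: zero quantum / promise content; the intended reduction (universal
gapped-circuit promise problem, `O(n²)` reductions) belongs to the REPAIRED route over
`BQTime`/`BPTime` (refuters rreview-0816 / rattack-15270-0 / rattack-15271; the planner restates).

References: S. Arora, B. Barak, *Computational Complexity: A Modern Approach*, CUP 2009,
Def. 7.2–7.3 [AroraBarakCC2009].
-/

-- the `Summit.QuantumAdvantage.QuantumAdvantage.…` namespace repeats summit = sub-problem (D-0017 layout)
set_option linter.dupNamespace false

namespace Summit.QuantumAdvantage.QuantumAdvantage.Theorems.CompactnessLiftLanguageLadder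

/-- **`PlImpliesCp` (stmt-QuantumAdvantage-15273) AS TYPED**: its consequent is the typed
`CompactnessPrinciple`, already a theorem (`compactnessPrinciple_proof`), so the promise-lift
hypothesis is not needed. [folklore] -/
theorem plImpliesCp_proof :
    Summit.QuantumAdvantage.QuantumAdvantage.Theses.CompactnessLift.PlImpliesCp := by
  unfold Summit.QuantumAdvantage.QuantumAdvantage.Theses.CompactnessLift.PlImpliesCp
  intro _
  exact CompactnessLiftPadding.compactnessPrinciple_proof

end Summit.QuantumAdvantage.QuantumAdvantage.Theorems.CompactnessLiftLanguageLadder
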